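import Summits.SmoothPoincare4.SmoothPoincare4.Theorems.SymplecticOrigamiOrigamiFoldExistenceShadowPleatsCleanDefs

/-!
# OUTER-CLEAN pleats — second vocabulary addendum of the line `shadow-pleats` for crux `OrigamiFoldExistence`
(item stmt-SmoothPoincare4-7844, route route-SmoothPoincare4-SymplecticOrigami; line lead seat c3, towards skeleton r5)

Skeleton r4 of the line (`Cruxes/OrigamiFoldExistence/Lines/shadow_pleats.lean`) has ONE open stub, PLEAT
NORMALISATION (every pleated round-rim position of a homotopy 4-sphere can be replaced by a CLEAN one,
`HasCleanPleatedPosition`, `…ShadowPleatsCleanDefs.lean`), which is SPC4-equivalent (kernel certificate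
`stub_pleatNormalisation_of_smoothPoincare4` plus the S4 worker's recognition theorem "all charts clean ⇒
`M ≅ S⁴`").  The lead's OUTER-CLEAN RECOGNITION THEOREM (paper, seat c3, analysis note
`Cruxes/OrigamiFoldExistence/OuterClean-analysis-c3.md`) shows that much less than cleanness already pins the
manifold down to a Schoenflies ball: if the charts are UN-NESTED and only the OUTER crease
`c_out^j = proj5 ∘ ι ∘ e_j (S(0,2))` of each chart is EMBEDDED (inner creases, holes and annuli as wild as
they like), then (SIDE LEMMA, by the normal degree of the regular homotopy `s ↦ proj5 ι e_j(s·)` from the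
inner to the outer crease: Hopf's theorem for the embedded region bounded by `c_out^j` and for the immersed
hole) the two germs born at `c_out^j` lie on its UNBOUNDED side, the sheet count of the outer sheet is
`n_P = 1_B − Σ_j 1_{U_out^j}`, the chimneys `Ū_out^j` are pairwise disjoint in the open polar ball `B_ρ`, the
outer sheet is shadow-EMBEDDED, and
    `M ≅ (S⁴ ∖ ⋃_j U_out^j) ∪ (k standard 4-balls glued by θ ↦ proj5 ι e_j(2θ))`;
so `M ∖ (one chart ball)` EMBEDS in `S⁴` (the punctured-embedding crux `PuncturedEmbeds` /
`SchsplitPuncturedEmbeds` of routes EuclideanOrigami / SchoenfliesSplit holds for `M`), and `M ≅ S⁴` as soon as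
the embedded 3-spheres `c_out^j ⊂ ℝ⁴` are smoothly standard (smooth 4-dimensional SCHOENFLIES, route items
`EuclideanOrigami.Schoenflies` = `SchoenfliesSplit.SchsplitSchoenflies` =
`Literature.Topology.FourManifolds.SmoothSchoenfliesConjectureFour`) via Cerf's `Γ₄ = 0`
(`SymplecticOrigami.CerfGammaFour`); for `k = 1`, conversely, `M ≅ S⁴` forces `Ū_out ≅ B̄⁴`.
Hence the open stub can be WEAKENED to OUTER NORMALISATION ("replace any pleated position by an un-nested
one whose outer creases are embedded"), whose slack is no longer provably zero: it implies SPC4 only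
together with Schoenflies.  This file lands the two predicates that statement needs, next to the line's
`…ShadowPleatsDefs` / `…ShadowPleatsCleanDefs`:

* `IsOuterCleanPleat ι e` — the chart shadow `proj5 ∘ ι ∘ e` is injective on the OUTER fold sphere
  `S(0,2)` (the outer crease is an embedded 3-sphere of `ℝ⁴`);
* `HasOuterCleanPleatedPosition M k` — a pleated round-rim position with `k` charts, all outer-clean, and
  UN-NESTED: the closed chart balls `e_j(B̄₂)` are pairwise disjoint;
* bookkeeping: `IsCleanPleat.isOuterCleanPleat` (clause 2 of cleanness restricted to the sphere),
  `HasOuterCleanPleatedPosition.hasPleatedPosition`, `hasOuterCleanPleatedPosition_zero_iff` (no charts: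
  both extra clauses vacuous), `hasOuterCleanPleatedPosition_one_iff` (one chart: un-nestedness vacuous),
  `HasCleanPleatedPosition.hasOuterCleanPleatedPosition_of_le_one` (for `k ≤ 1` clean ⇒ outer-clean
  formally; for `k ≥ 2` this needs the paper lemma "all-clean ⇒ un-nested", S4 worker (C0), not claimed);
* NON-VACUITY (sorry-free): the radial zig-zag shadow is outer-clean (`isOuterCleanPleat_zigzagModel`).

Deliberately NOT here: the outer-clean recognition theorem and the outer-normalisation stub (CLAIMS of the
line, to be registered in skeleton r5), and any use of the Schoenflies / Cerf route items.
-/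

noncomputable section

-- the prescribed namespace `Summit.<P>.<Sub>.…` duplicates `SmoothPoincare4` (P = Sub)
set_option linter.dupNamespace false

open scoped Manifold ContDiff Topology
open Set Function Metric

namespace Summit.SmoothPoincare4.SmoothPoincare4.Theorems.OrigamiFoldExistence.ShadowPleats

/-! ### The outer-cleanness predicate -/

/-- A pleat chart `e : ℝ⁴ → M` of `ι : M → ℝ⁵` is OUTER-CLEAN if the chart shadow `proj5 ∘ ι ∘ e` is
injective on the OUTER fold sphere `S(0,2)`, i.e. the outer crease `c_out = proj5 ι e(S(0,2))` is an
EMBEDDED 3-sphere of `ℝ⁴` (for a Whitney fold the crease map is an immersion, so injective = embedded).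
The inner crease, the hole and the annulus are unrestricted.  (Line `shadow-pleats`, lead seat c3.) -/
def IsOuterCleanPleat {M : Type} (ι : M → EuclideanSpace ℝ (Fin 5)) (e : EuclideanSpace ℝ (Fin 4) → M) :
    Prop :=
  Set.InjOn (proj5 ∘ ι ∘ e) (Metric.sphere 0 2)

/-- `M` admits a pleated round-rim shadow position with `k` pleat charts that are all OUTER-CLEAN and
pairwise UN-NESTED (the closed chart balls `e_j(B̄₂)` are pairwise disjoint; nesting in another chart's
hole or annulus, which `IsPleatedPosition` allows, is excluded).  For `k = 0` this is `HasPleatedPosition M 0`,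
for `k = 1` the disjointness clause is vacuous (`hasOuterCleanPleatedPosition_one_iff`).  Hypothesis of the
lead's outer-clean recognition theorem (skeleton r5). -/
def HasOuterCleanPleatedPosition (M : Type) [TopologicalSpace M]
    [ChartedSpace (EuclideanSpace ℝ (Fin 4)) M] (k : ℕ) : Prop :=
  ∃ (ι : M → EuclideanSpace ℝ (Fin 5)) (δ : ℝ) (e : Fin k → EuclideanSpace ℝ (Fin 4) → M),
    IsPleatedPosition ι δ e ∧ (∀ j, IsOuterCleanPleat ι (e j)) ∧
      Pairwise (Function.onFun Disjoint fun j => e j '' Metric.closedBall 0 2)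

/-! ### Bookkeeping -/

/-- A clean chart is outer-clean: clause 2 of `IsCleanPleat` (injectivity on the closed annulus
`{1 ≤ |u| ≤ 2}`) restricted to the outer sphere. [folklore] -/
theorem IsCleanPleat.isOuterCleanPleat {M : Type} {ι : M → EuclideanSpace ℝ (Fin 5)}
    {e : EuclideanSpace ℝ (Fin 4) → M} (h : IsCleanPleat ι e) : IsOuterCleanPleat ι e := by
  obtain ⟨ε, -, -, hann, -⟩ := h
  refine hann.mono fun u hu => ?_
  rw [mem_sphere_zero_iff_norm] at hu
  refine ⟨mem_closedBall_zero_iff.2 hu.le, ?_⟩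
  rw [mem_ball_zero_iff, hu]
  norm_num

/-- An outer-clean un-nested position is in particular a position. [folklore] -/
theorem HasOuterCleanPleatedPosition.hasPleatedPosition {M : Type} [TopologicalSpace M]
    [ChartedSpace (EuclideanSpace ℝ (Fin 4)) M] {k : ℕ} (h : HasOuterCleanPleatedPosition M k) :
    HasPleatedPosition M k := by
  obtain ⟨ι, δ, e, hι, -, -⟩ := h
  exact ⟨ι, δ, e, hι⟩

/-- With no charts both extra clauses are vacuous:
`HasOuterCleanPleatedPosition M 0 ↔ HasPleatedPosition M 0`. [folklore] -/
theorem hasOuterCleanPleatedPosition_zero_iff (M : Type) [TopologicalSpace M]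
    [ChartedSpace (EuclideanSpace ℝ (Fin 4)) M] :
    HasOuterCleanPleatedPosition M 0 ↔ HasPleatedPosition M 0 := by
  refine ⟨HasOuterCleanPleatedPosition.hasPleatedPosition, fun ⟨ι, δ, e, hι⟩ => ?_⟩
  exact ⟨ι, δ, e, hι, fun j => Fin.elim0 j, fun j => Fin.elim0 j⟩

/-- With one chart the disjointness clause is vacuous and `∀ j` is `j = 0`. [folklore] -/
theorem hasOuterCleanPleatedPosition_one_iff (M : Type) [TopologicalSpace M]
    [ChartedSpace (EuclideanSpace ℝ (Fin 4)) M] :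
    HasOuterCleanPleatedPosition M 1 ↔
      ∃ (ι : M → EuclideanSpace ℝ (Fin 5)) (δ : ℝ) (e : Fin 1 → EuclideanSpace ℝ (Fin 4) → M),
        IsPleatedPosition ι δ e ∧ IsOuterCleanPleat ι (e 0) := by
  constructor
  · rintro ⟨ι, δ, e, hι, hc, -⟩
    exact ⟨ι, δ, e, hι, hc 0⟩
  · rintro ⟨ι, δ, e, hι, hc⟩
    refine ⟨ι, δ, e, hι, fun j => ?_, fun i j hij => ?_⟩
    · rwa [Fin.fin_one_eq_zero j]
    · exact absurd (Subsingleton.elim i j) hij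

/-- For at most one chart, a clean position is an outer-clean un-nested position (for `k ≥ 2` charts this
needs the paper lemma "all charts clean ⇒ un-nested", not claimed here). [folklore] -/
theorem HasCleanPleatedPosition.hasOuterCleanPleatedPosition_of_le_one {M : Type} [TopologicalSpace M]
    [ChartedSpace (EuclideanSpace ℝ (Fin 4)) M] {k : ℕ} (hk : k ≤ 1)
    (h : HasCleanPleatedPosition M k) : HasOuterCleanPleatedPosition M k := by
  obtain ⟨ι, δ, e, hι, hc⟩ := h
  refine ⟨ι, δ, e, hι, fun j => (hc j).isOuterCleanPleat, fun i j hij => ?_⟩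
  haveI : Subsingleton (Fin k) := by
    interval_cases k <;> infer_instance
  exact absurd (Subsingleton.elim i j) hij

/-! ### Non-vacuity: the radial zig-zag model is outer-clean -/

/-- **`IsOuterCleanPleat` is satisfiable**: the zig-zag shadow of `…CleanDefs` (`M = ℝ⁴`, `e = id`,
`ι = embedL ∘ G`) is outer-clean, being clean (`isCleanPleat_zigzagModel`). [folklore] -/
theorem isOuterCleanPleat_zigzagModel :
    IsOuterCleanPleat (fun u : EuclideanSpace ℝ (Fin 4) => embedL (CleanModel.G u)) id :=
  isCleanPleat_zigzagModel.isOuterCleanPleat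

end Summit.SmoothPoincare4.SmoothPoincare4.Theorems.OrigamiFoldExistence.ShadowPleats

end
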